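import Summits.KontsevichZagierPeriods.KontsevichZagierPeriods.Theses.Deregularisation
import Literature.NumberTheory.Transcendental.KZRegCalculusProofs

/-!
# D1 — the sandwich decomposition of `DeregularisationShell` (crux-strategist, stmt-KontsevichZagierPeriods-3903)

Pieces: X₁ = `RegConservative2` (= `KZreg.Conservative`, item stmt-4952) and X₂ = `RegKernel2`
(item stmt-14491). Assembly = the INSTANCE `L := KZreg.FormalRep` of the shell, with
`rel := KZreg.relations ⊔ KZreg.defects` (the refuter's repaired reading; `rel := KZreg.relations`
alone is refuted, `KZreg.not_kernelConjecture`), `ev := KZreg.eval`, `ι := KZreg.incl`,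
`Λ := KZreg.Λ`. Tree lemmas used: `Λ_incl`, `eval_incl`, `eval_Λ`, `sub_incl_Λ_mem_defects`,
`defects_le_ker_Λ`, `conservative_iff_le_comap`.

Also recorded: the same implication through the costume-free instance `L := KZ.FormalRep`,
`rel := (KZreg.relations).map Λ` (5 lines), which exhibits the seam: the two open pieces meet only
in the subgroup sandwich `ker KZ.eval ≤ Λ(KZreg.relations) ≤ KZ.relations`.
-/

open Literature.NumberTheory.Transcendental

namespace Summit.KontsevichZagierPeriods.KontsevichZagierPeriods.Theses.Deregularisation

/-- **Assembly (KZreg instance).** `RegConservative2 → RegKernel2 → DeregularisationShell`. -/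
theorem deregularisationShell_of_subs (h₁ : RegConservative2) (h₂ : RegKernel2) :
    DeregularisationShell := by
  refine ⟨KZreg.FormalRep, inferInstance, KZreg.relations ⊔ KZreg.defects, KZreg.eval, KZreg.incl,
    KZreg.Λ, KZreg.Λ_incl, KZreg.eval_incl, ?_, ?_⟩
  · -- ker ev ≤ rel: a regularised combination of value 0 de-regularises to a vanishing combination
    -- of convergent reps (`eval_Λ`), which X₂ reaches from a regularised relation `d'`; the
    -- difference `d - d'` is killed by `Λ`, hence a regularisation defect.
    intro d hd
    have h0 : KZ.eval (KZreg.Λ d) = 0 := by rw [KZreg.eval_Λ]; exact hd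
    obtain ⟨d', hd', hΛ⟩ := h₂ _ h0
    have hsplit : d = d' + (d - d') := by abel
    rw [hsplit]
    refine AddSubgroup.add_mem_sup hd' ?_
    have hdef : d - d' = (d - KZreg.incl (KZreg.Λ d)) - (d' - KZreg.incl (KZreg.Λ d')) := by
      rw [hΛ]; abel
    rw [hdef]
    exact sub_mem (KZreg.sub_incl_Λ_mem_defects d) (KZreg.sub_incl_Λ_mem_defects d')
  · -- Λ rel ≤ KZ.relations: X₁ on `relations`, and `Λ` kills `defects`.
    intro d hd
    have hle : KZreg.relations ⊔ KZreg.defects ≤ KZ.relations.comap KZreg.Λ := by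
      refine sup_le (KZreg.conservative_iff_le_comap.1 h₁) fun x hx => ?_
      rw [AddSubgroup.mem_comap, (AddMonoidHom.mem_ker).1 (KZreg.defects_le_ker_Λ hx)]
      exact zero_mem _
    exact hle hd

/-- The route's glue item `ShellOfKZreg` (stmt-KontsevichZagierPeriods-14296) is this assembly. -/
theorem shellOfKZreg_holds : ShellOfKZreg := deregularisationShell_of_subs

/-- **The seam, undisguised.** The costume-free instance `L := KZ.FormalRep`, `ι = Λ = id`,
`ev := KZ.eval`, `rel := Λ(KZreg.relations)`: then `ker ev ≤ rel` IS `RegKernel2` and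
`Λ rel ≤ KZ.relations` IS `RegConservative2`. -/
theorem deregularisationShell_of_subs' (h₁ : RegConservative2) (h₂ : RegKernel2) :
    DeregularisationShell := by
  refine ⟨KZ.FormalRep, inferInstance, KZreg.relations.map KZreg.Λ, KZ.eval, AddMonoidHom.id _,
    AddMonoidHom.id _, fun _ => rfl, fun _ => rfl, fun c hc => ?_, ?_⟩
  · obtain ⟨d, hd, hdc⟩ := h₂ c hc
    exact ⟨d, hd, hdc⟩
  · rintro _ ⟨d, hd, rfl⟩
    exact h₁ d hd

/-- And the two pieces give the kernel conjecture in three lines (cf. the landed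
`RegKernel2.Negative.regConservative2_and_regKernel2_iff_kzKernelConjecture`). -/
theorem kzKernelConjecture_of_subs (h₁ : RegConservative2) (h₂ : RegKernel2) :
    KZKernelConjecture := by
  intro c h0
  obtain ⟨d, hd, rfl⟩ := h₂ c h0
  exact h₁ d hd

end Summit.KontsevichZagierPeriods.KontsevichZagierPeriods.Theses.Deregularisation
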